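import Literature.NumberTheory.LFunctions.ExplicitLandauPageFamily
import Literature.NumberTheory.LFunctions.SiegelZeroFamilyRepulsionReading
import HarnessLib

/-!
# Thorner–Zaman 2024, §2.2: the maximal real zero `β₁(Q)` is attained, and Theorem 2.6 (second
# assertion) follows from Platt's computation and Bordignon's bound (proofs)

Topic `Literature/NumberTheory/LFunctions` (namespace `Literature.NumberTheory.LFunctions`; paper
objects in `ThornerZaman2024`). PROOF LAYER, sibling of the statement file
`ExplicitLandauPageFamily.lean` (Thorner–Zaman, Forum Math. **36** (2024) = arXiv:2208.11123, §2.2,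
named facts `thornerZaman2024_lemma24 / _corollary25 / _theorem26a / _theorem26b`). Everything here
is PROVED; no definition, no named fact, nothing restated. Written for the cell `landau-siegel`
(rung F-S3, §C reader r3).

## What is proved

* `ThornerZaman2024.realZeroSet_inter_Ioi_finite` — for every `σ₀ > 0` the real zeros `β > σ₀` of
  `𝓛(s,Q) = ∏_{q ≤ Q} ∏_{χ primitive} L(s,χ)` form a FINITE set: finitely many moduli `q ≤ Q` and
  characters, and for each primitive `χ` of modulus `q ≥ 2` the zeros with `Re > σ₀ ≥ 0`, `Im = 0`
  are finitely many (tree `BondarenkoHeap2026.zeroSetRe_finite`), while `ζ` (modulus `1`) has no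
  real zero in `(0, ∞)` (tree `riemannZeta_ofReal_ne_zero_of_pos_of_lt_one`, Mathlib
  `riemannZeta_ne_zero_of_one_le_re`).
* `ThornerZaman2024.betaOne_mem_realZeroSet` — **attainment**: if `β₁(Q) = sSup (realZeroSet Q)`
  exceeds some `σ₀ > 0`, then `β₁(Q) ∈ realZeroSet Q`, i.e. the supremum of the source's display
  (1.1) ("`β₁(Q) := max{β ∈ ℝ : 𝓛(β,Q) = 0}`") is a maximum, as printed; unpacked as
  `ThornerZaman2024.exists_primitive_of_lt_betaOne` (a modulus `2 ≤ q₁ ≤ Q` and a primitive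
  `χ₁ (mod q₁)` with `L(β₁(Q),χ₁) = 0`) and `ThornerZaman2024.betaOne_lt_one`.
* `thornerZaman2024_theorem26b_of_platt_bordignon` — **Theorem 2.6, second assertion, DERIVED**
  from three named facts already in the tree: Platt 2016 Thms 7.1–7.2 (`platt2016_theorem71`,
  `platt2016_theorem72`: no real zero in `(0,1)` for any primitive `χ` of modulus `2 ≤ q ≤ 4·10⁵`)
  and Bordignon's bound in Benli–Goel–Twiss–Zaman's form (`BGTZ2025.theorem28_bordignon` =
  `HypothesisB 100 (1/2)`). This follows the printed proof ("The bound on `β₁(Q)` is proved in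
  [Bordignon, Bordignon2]. Lemma 2.3 and Corollary 2.5 imply the rest", p. 5): attainment gives
  `χ₁ (mod q₁)`, `q₁ ≤ Q`, with `L(β₁(Q),χ₁) = 0`; Platt (the source's Lemma 2.2) forces
  `q₁ > 400 000`, hence `Q > 400 000`; then either `β₁(Q) > 1 − 1/(10 log q₁)` and Bordignon's
  window applies, or `β₁(Q) ≤ 1 − 1/(10 log q₁) ≤ 1 − 100/(√q₁ (log q₁)²)` outright because
  `√q₁ log q₁ ≥ 1000` for `q₁ > 400 000`. (McCurley's Lemma 2.3 is needed in print only for the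
  simplicity of `β₁(Q)` and the uniqueness of `χ₁`, which the tree's rendering of Theorem 2.6 does
  not carry.)

Effect on the ledger: the named fact `thornerZaman2024_theorem26b` is a CONSEQUENCE of
`platt2016_theorem71 ∧ platt2016_theorem72 ∧ BGTZ2025.theorem28_bordignon`; it adds no independent
hypothesis to any chain that already assumes those (e.g. the §E Deuring–Heilbronn menu).

WHAT THIS IS NOT: no discharge of any named fact (Platt's computation and Bordignon's theorem stay
hypotheses); no claim about Landau–Siegel zeros. The first assertion of Theorem 2.6
(`thornerZaman2024_theorem26a`) is NOT derived in Parts 1–3: its printed proof runs through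
McCurley's region with the CLOSED boundary `Re(s) ≥ 1 − c/log max{q, q|Im s|}` (the source's
Lemma 2.3), whereas the tree's `McCurley1984_theorem1` is rendered with the open boundary, so the
boundary case `q = Q`, `Re ρ = 1 − c/log max{Q, Q|Im ρ|}` is not reachable from it (Part 3 derives
the open form, conclusion `≤`). **Part 4 (2026-08-28) derives the named fact
`thornerZaman2024_theorem26a` IN FULL** (`thornerZaman2024_theorem26a_of_mccurleyClosed_platt_lemma24`)
from McCurley's Theorem 1 AS PRINTED — J. Number Theory 19 (1984) p. 8 prints the CLOSED region
`{s : σ ⩾ 1 − 1/(R log M)}` (page image checked; the tree's `McCurley1984_theorem1_closed`,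
`ZeroFreeRegionUpTo.lean`) — together with `platt2016_theorem71/72`, `platt_trudgian_numerical_rh`,
`zero_free_region_mossinghoff_trudgian_yang` and `thornerZaman2024_lemma24`.

«The programme SEARCHES and TYPES; no claim about Landau–Siegel zeros, Theorems 1–2 of
arXiv:2211.02515 or a repaired Margin232 until a kernel theorem says so.»

## References

* [ThornerZaman2024LogFree] J. Thorner, A. Zaman, Forum Math. 36 (2024) 1059–1080,
  doi:10.1515/forum-2023-0091 = arXiv:2208.11123 — §2.2, Lemma 2.2, Theorem 2.6 and its proof (p. 5).
* [Platt2016GRH] D. J. Platt, Math. Comp. 85 (2016) 3009–3027, Theorems 7.1–7.2 (tree: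
  `platt2016_theorem71`, `platt2016_theorem72`).
* [BenliGoelTwissZaman2025] K. Benli, S. Goel, H. Twiss, A. Zaman, Proc. AMS 154 (2026) =
  arXiv:2410.06082, Theorem 2.8 (Bordignon's bound; tree: `BGTZ2025.theorem28_bordignon`).
* M. Bordignon, J. Number Theory 201 (2019) 68–76, Thm 1.3; J. Number Theory 210 (2020) 481–487,
  Thm 1.3 (the printed constants 800 (odd) / 100 (even), `q > 4·10⁵`).
-/

noncomputable section

open scoped Classical

namespace Literature.NumberTheory.LFunctions

namespace ThornerZaman2024

open BondarenkoHeap2026 (zeroSetRe zeroSetRe_finite mem_zeroSetRe)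

/-- For one character `χ` of modulus `n ≥ 1` and a floor `σ₀ > 0`, the real zeros `β > σ₀` of
`L(s,χ)` with `χ` primitive form a finite set: for `n ≥ 2` they inject (via `β ↦ (β : ℂ)`) into the
finite zero set `zeroSetRe χ σ₀ 0` of the tree; for `n = 1` (`L = ζ`) there is none, since `ζ` has no
real zero in `(0,1)` and none with `Re s ≥ 1`; a non-primitive `χ` contributes the empty set.
[cite: ThornerZaman2024LogFree, §1 (display (1.1) defining β₁(Q) as a maximum)] -/
private theorem finite_realZeros_char {n : ℕ} [NeZero n] (χ : DirichletCharacter ℂ n) {σ₀ : ℝ}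
    (hσ₀ : 0 < σ₀) : {β : ℝ | σ₀ < β ∧ χ.IsPrimitive ∧ χ.LFunction β = 0}.Finite := by
  rcases Nat.lt_or_ge 1 n with hn | hn
  · by_cases hprim : χ.IsPrimitive
    · have hne : χ ≠ 1 := SiegelZeroQuality.ne_one_of_isPrimitive hprim (by omega)
      refine ((zeroSetRe_finite hne hσ₀.le 0).image Complex.re).subset ?_
      rintro β ⟨hβ, -, hz⟩
      refine ⟨(β : ℂ), ?_, Complex.ofReal_re β⟩
      rw [mem_zeroSetRe]
      exact ⟨hz, by simpa using hβ, by simp⟩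
    · refine Set.finite_empty.subset ?_
      rintro β ⟨-, h, -⟩
      exact hprim h
  · have hn1 : n = 1 := le_antisymm hn (Nat.one_le_iff_ne_zero.mpr (NeZero.ne n))
    subst hn1
    refine Set.finite_empty.subset ?_
    rintro β ⟨hβ, -, hz⟩
    rw [DirichletCharacter.LFunction_modOne_eq] at hz
    rcases lt_or_ge β 1 with h1 | h1
    · exact riemannZeta_ofReal_ne_zero_of_pos_of_lt_one β (hσ₀.trans hβ) h1 hz
    · exact riemannZeta_ne_zero_of_one_le_re (s := (β : ℂ)) (by simpa using h1) hz

/-- **The real zeros of `𝓛(s,Q)` above any positive floor are finitely many**: for `σ₀ > 0`,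
`realZeroSet Q ∩ (σ₀, ∞)` is finite (finitely many moduli `q = i + 1 ≤ ⌊Q⌋`, finitely many
characters for each, and `finite_realZeros_char`). This is what makes `β₁(Q)` a maximum.
[cite: ThornerZaman2024LogFree, §1 (display (1.1) defining β₁(Q) as a maximum)] -/
theorem realZeroSet_inter_Ioi_finite (Q : ℝ) {σ₀ : ℝ} (hσ₀ : 0 < σ₀) :
    (realZeroSet Q ∩ Set.Ioi σ₀).Finite := by
  have hfin : (⋃ i : Fin ⌊Q⌋₊, ⋃ χ : DirichletCharacter ℂ (i.val + 1),
      {β : ℝ | σ₀ < β ∧ χ.IsPrimitive ∧ χ.LFunction β = 0}).Finite :=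
    Set.finite_iUnion fun i ↦ Set.finite_iUnion fun χ ↦ finite_realZeros_char χ hσ₀
  refine hfin.subset ?_
  rintro β ⟨⟨i, hi, χ, hprim, hz⟩, hβ⟩
  exact Set.mem_iUnion.2 ⟨⟨i, hi⟩, Set.mem_iUnion.2 ⟨χ, hβ, hprim, hz⟩⟩

/-- **Attainment of `β₁(Q)`.** If `β₁(Q) = sSup (realZeroSet Q)` exceeds some `σ₀ > 0`, then
`β₁(Q)` belongs to `realZeroSet Q`: the real zero set is then nonempty and bounded above (otherwise
its `sSup` would be the junk value `0`), its part above `σ₀` is finite and nonempty, and the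
supremum of the whole set is the largest element of that finite part. So the source's
"`β₁(Q) := max{β ∈ ℝ : 𝓛(β,Q) = 0}`" is a genuine maximum whenever `β₁(Q) > 0`.
[cite: ThornerZaman2024LogFree, §1 (display (1.1) defining β₁(Q) as a maximum)] -/
theorem betaOne_mem_realZeroSet {Q σ₀ : ℝ} (hσ₀ : 0 < σ₀) (h : σ₀ < betaOne Q) :
    betaOne Q ∈ realZeroSet Q := by
  have hpos : 0 < betaOne Q := hσ₀.trans h
  have hne : (realZeroSet Q).Nonempty := by
    by_contra hS
    rw [Set.not_nonempty_iff_eq_empty] at hS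
    have : betaOne Q = 0 := by rw [betaOne, hS, Real.sSup_empty]
    linarith
  have hbdd : BddAbove (realZeroSet Q) := by
    by_contra hS
    have : betaOne Q = 0 := by rw [betaOne, Real.sSup_of_not_bddAbove hS]
    linarith
  -- the finite, nonempty part above `σ₀`
  set F := realZeroSet Q ∩ Set.Ioi σ₀ with hF
  have hFfin : F.Finite := realZeroSet_inter_Ioi_finite Q hσ₀
  have hFne : F.Nonempty := by
    obtain ⟨x, hx, hσx⟩ := exists_lt_of_lt_csSup hne (h : σ₀ < sSup (realZeroSet Q))
    exact ⟨x, hx, hσx⟩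
  obtain ⟨m, hmF, hmax⟩ := Set.exists_max_image F id hFfin hFne
  have hm_le : m ≤ betaOne Q := le_csSup hbdd hmF.1
  have hle_m : betaOne Q ≤ m := by
    refine csSup_le hne fun b hb ↦ ?_
    rcases le_or_gt b σ₀ with hbσ | hbσ
    · exact hbσ.trans (le_of_lt hmF.2)
    · exact hmax b ⟨hb, hbσ⟩
  have heq : betaOne Q = m := le_antisymm hle_m hm_le
  rw [heq]
  exact hmF.1

/-- **Attainment, unpacked**: if `β₁(Q) > σ₀ > 0` there are a modulus `q₁` with `2 ≤ q₁ ≤ Q` and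
a primitive character `χ₁ (mod q₁)` with `L(β₁(Q), χ₁) = 0` (the modulus `1`, i.e. `ζ`, is
excluded because `ζ` has no real zero in `(0, ∞)`).
[cite: ThornerZaman2024LogFree, §1 (display (1.1)) and Theorem 2.6 (proof, p. 5)] -/
theorem exists_primitive_of_lt_betaOne {Q σ₀ : ℝ} (hσ₀ : 0 < σ₀) (h : σ₀ < betaOne Q) :
    ∃ (q₁ : ℕ) (_ : NeZero q₁) (χ₁ : DirichletCharacter ℂ q₁),
      2 ≤ q₁ ∧ (q₁ : ℝ) ≤ Q ∧ χ₁.IsPrimitive ∧ χ₁.LFunction (betaOne Q) = 0 := by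
  have hpos : 0 < betaOne Q := hσ₀.trans h
  obtain ⟨i, hi, χ₁, hprim, hz⟩ := betaOne_mem_realZeroSet hσ₀ h
  have hQ0 : 0 ≤ Q := by
    by_contra hQ
    have : ⌊Q⌋₊ = 0 := Nat.floor_of_nonpos (le_of_lt (not_le.mp hQ))
    omega
  have hiQ : ((i + 1 : ℕ) : ℝ) ≤ Q := by
    have h1 : i + 1 ≤ ⌊Q⌋₊ := hi
    exact le_trans (by exact_mod_cast h1) (Nat.floor_le hQ0)
  refine ⟨i + 1, inferInstance, χ₁, ?_, hiQ, hprim, hz⟩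
  -- `i + 1 ≠ 1`: otherwise `ζ(β₁(Q)) = 0` with `β₁(Q) > 0`
  by_contra hlt
  have hi0 : i = 0 := by omega
  subst hi0
  rw [DirichletCharacter.LFunction_modOne_eq] at hz
  rcases lt_or_ge (betaOne Q) 1 with h1 | h1
  · exact riemannZeta_ofReal_ne_zero_of_pos_of_lt_one _ hpos h1 hz
  · exact riemannZeta_ne_zero_of_one_le_re (s := ((betaOne Q : ℝ) : ℂ)) (by simpa using h1) hz

/-- **`β₁(Q) < 1`** once `β₁(Q) > 0`: it is a zero of some primitive `L(s,χ₁)` of modulus `≥ 2`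
(`exists_primitive_of_lt_betaOne`), and such an `L`-function does not vanish on `Re s ≥ 1`
(Mathlib `DirichletCharacter.LFunction_ne_zero_of_one_le_re`). (The source: "`𝓛(σ,Q) ≠ 0` for
`σ ≥ 1`. Thus `β₁(Q) ∈ [0,1)`", Remark after Theorem 1.2.)
[cite: ThornerZaman2024LogFree, Remark after Theorem 1.2] -/
theorem betaOne_lt_one {Q σ₀ : ℝ} (hσ₀ : 0 < σ₀) (h : σ₀ < betaOne Q) : betaOne Q < 1 := by
  obtain ⟨q₁, _, χ₁, hq2, -, hprim, hz⟩ := exists_primitive_of_lt_betaOne hσ₀ h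
  have hne : χ₁ ≠ 1 := SiegelZeroQuality.ne_one_of_isPrimitive hprim hq2
  by_contra hge
  exact DirichletCharacter.LFunction_ne_zero_of_one_le_re χ₁ (Or.inl hne)
    (by simpa using not_lt.mp hge) hz

/-- Numerical input of the proof of Theorem 2.6: `zfrConst = 1/9.645908801 < 1`, so that for
`Q ≥ 3` the floor `1 − zfrConst/log Q` is positive (`log 3 > 1`).
[cite: ThornerZaman2024LogFree, Lemma 2.3 (the constant c)] -/
theorem zfrConst_lt_one : zfrConst < 1 := by
  unfold zfrConst; norm_num

end ThornerZaman2024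

open ThornerZaman2024

/-- `1 < log 3` (`e < 3`). [folklore] -/
private theorem one_lt_log_three : 1 < Real.log 3 := by
  rw [Real.lt_log_iff_exp_lt (by norm_num)]
  have := Real.exp_one_lt_d9
  linarith

/-- Platt's Theorems 7.1–7.2 exclude every real zero in `(0,1)` of every primitive `χ` of modulus
`2 ≤ q ≤ 400 000` (complex characters included): by Theorem 7.1 such a zero lies on the critical
line (the verified height `10⁸/q ≥ 250` covers the real axis), so it is `1/2`, which Theorem 7.2
excludes. (This is the source's Lemma 2.2: "`L(s,χ)` has no real nontrivial zeros".)
[cite: ThornerZaman2024LogFree, Lemma 2.2] [cite: Platt2016GRH, Theorems 7.1 and 7.2] -/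
theorem LFunction_ofReal_ne_zero_of_platt2016 (h71 : platt2016_theorem71) (h72 : platt2016_theorem72)
    {q : ℕ} [NeZero q] (hq2 : 2 ≤ q) (hq : q ≤ 400000) {χ : DirichletCharacter ℂ q}
    (hprim : χ.IsPrimitive) {σ : ℝ} (hσ0 : 0 < σ) (hσ1 : σ < 1) : χ.LFunction σ ≠ 0 := by
  intro hzero
  have hne : χ ≠ 1 := SiegelZeroQuality.ne_one_of_isPrimitive hprim hq2
  have hgrh := grhUpTo_of_platt2016 (q := q) h71 hq χ hne
  have hhalf : ((σ : ℂ)).re = 1 / 2 :=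
    hgrh σ hzero (by simpa using hσ0) (by simpa using hσ1)
      (by
        simp only [Complex.ofReal_im, abs_zero]
        positivity)
  have hσ : σ = 1 / 2 := by simpa using hhalf
  subst hσ
  exact LFunction_one_half_ne_zero_of_platt2016 h72 (by omega) hne (by simpa using hzero)

/-- The elementary inequality behind the case split: for `q₁ > 400 000`,
`100/(√q₁ (log q₁)²) ≤ 1/(10 log q₁)`, i.e. `1000 ≤ √q₁ log q₁` (indeed `√q₁ > 632` and
`log q₁ > log 3 > 1`… we use the cruder `√q₁ ≥ 600`, `log q₁ ≥ 2`).
[cite: ThornerZaman2024LogFree, Theorem 2.6 (proof)] -/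
private theorem bordignon_window_le {q₁ : ℕ} (hq : 400000 < q₁) :
    100 / (Real.sqrt q₁ * Real.log q₁ ^ 2) ≤ 1 / (10 * Real.log q₁) := by
  have hq' : (400000 : ℝ) < q₁ := by exact_mod_cast hq
  have hsqrt : (600 : ℝ) ≤ Real.sqrt q₁ := by
    rw [show (600 : ℝ) = Real.sqrt (600 ^ 2) by rw [Real.sqrt_sq (by norm_num)]]
    exact Real.sqrt_le_sqrt (by nlinarith)
  have hlog : (2 : ℝ) ≤ Real.log q₁ := by
    rw [Real.le_log_iff_exp_le (by linarith)]
    have h := Real.exp_one_lt_d9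
    have h2 : Real.exp 2 = Real.exp 1 * Real.exp 1 := by rw [← Real.exp_add]; norm_num
    have hee : Real.exp 1 * Real.exp 1 < 2.7182818286 * 2.7182818286 :=
      mul_lt_mul'' h h (le_of_lt (Real.exp_pos 1)) (le_of_lt (Real.exp_pos 1))
    rw [h2]
    linarith
  have hlogpos : 0 < Real.log q₁ := by linarith
  rw [div_le_div_iff₀ (by positivity) (by positivity)]
  -- 100 * (10 * log q₁) ≤ 1 * (√q₁ * log q₁ ^ 2)
  nlinarith [mul_le_mul hsqrt hlog (by norm_num) (by positivity)]

/-- **Thorner–Zaman 2024, Theorem 2.6, second assertion — DERIVED from Platt 2016 (Thms 7.1–7.2)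
and Bordignon's bound (in Benli–Goel–Twiss–Zaman's form `HypothesisB 100 (1/2)`).** Printed proof,
p. 5: "The bound on `β₁(Q)` is proved in [Bordignon, Bordignon2]. Lemma 2.3 and Corollary 2.5 imply
the rest." In the tree's rendering (simplicity and uniqueness dropped): `β₁(Q) ≥ 1 − c/log Q > 0`
is attained at a primitive `χ₁ (mod q₁)`, `2 ≤ q₁ ≤ Q` (`exists_primitive_of_lt_betaOne`), with
`β₁(Q) < 1` (`betaOne_lt_one`); Platt forces `q₁ > 400 000` (`LFunction_ofReal_ne_zero_of_platt2016`),
so `Q > 400 000`; finally either `β₁(Q) > 1 − 1/(10 log q₁)` and `BGTZ2025.theorem28_bordignon`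
gives `β₁(Q) < 1 − 100/(√q₁ (log q₁)²)`, or `β₁(Q) ≤ 1 − 1/(10 log q₁) ≤ 1 − 100/(√q₁ (log q₁)²)`
by `bordignon_window_le`.
[cite: ThornerZaman2024LogFree, Theorem 2.6 (second assertion) and its proof]
[cite: Platt2016GRH, Theorems 7.1 and 7.2] [cite: BenliGoelTwissZaman2025, Theorem 2.8] -/
theorem thornerZaman2024_theorem26b_of_platt_bordignon (h71 : platt2016_theorem71)
    (h72 : platt2016_theorem72) (hB : BGTZ2025.theorem28_bordignon) :
    thornerZaman2024_theorem26b := by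
  intro Q hQ3 hβ
  -- the floor `1 − c/log Q` is positive
  have hlogQ : 1 < Real.log Q :=
    one_lt_log_three.trans_le (Real.log_le_log (by norm_num) hQ3)
  have hlogQpos : 0 < Real.log Q := by linarith
  have hc1 := zfrConst_lt_one
  have hfloor : 0 < 1 - zfrConst / Real.log Q := by
    have : zfrConst / Real.log Q < 1 := by
      rw [div_lt_one hlogQpos]; linarith
    linarith
  -- attainment at some primitive `χ₁` mod `q₁`, `2 ≤ q₁ ≤ Q`
  set σ₀ : ℝ := (1 - zfrConst / Real.log Q) / 2 with hσ₀def
  have hσ₀ : 0 < σ₀ := by positivity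
  have hσβ : σ₀ < betaOne Q := by
    have : σ₀ < 1 - zfrConst / Real.log Q := by rw [hσ₀def]; linarith
    exact this.trans_le hβ
  have hβpos : 0 < betaOne Q := hσ₀.trans hσβ
  have hβ1 : betaOne Q < 1 := betaOne_lt_one hσ₀ hσβ
  obtain ⟨q₁, hq₁ne, χ₁, hq2, hq₁Q, hprim, hz⟩ := exists_primitive_of_lt_betaOne hσ₀ hσβ
  -- Platt: `q₁ > 400 000`
  have hq₁ : 400000 < q₁ := by
    by_contra hle
    exact LFunction_ofReal_ne_zero_of_platt2016 h71 h72 hq2 (not_lt.mp hle) hprim hβpos hβ1 hz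
  have hq₁R : (400000 : ℝ) < q₁ := by exact_mod_cast hq₁
  refine ⟨hq₁R.trans_le hq₁Q, q₁, hq₁ne, χ₁, hq₁, hq₁Q, hprim, hz, ?_⟩
  -- the bound, by the case split on Bordignon's window
  have hwin := bordignon_window_le hq₁
  rcases lt_or_ge (1 - 1 / (10 * Real.log q₁)) (betaOne Q) with hw | hw
  · have h3 : 3 ≤ q₁ := by omega
    have hb := hB q₁ h3 χ₁ (betaOne Q) hw hβ1 hz
    -- `hb : betaOne Q < 1 - 100 / (q₁ ^ (1/2) * log q₁ ^ 2)`
    have hsq : ((q₁ : ℝ)) ^ ((1 : ℝ) / 2) = Real.sqrt q₁ := by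
      rw [Real.sqrt_eq_rpow]
    rw [hsq] at hb
    exact hb.le
  · linarith

/-! ### Part 2 — Corollary 2.5 (Page, family `q ≤ Q`) from Lemma 2.4, Platt, and a
single-character Page lemma

The printed proof of Corollary 2.5 (p. 5) shows, from Lemma 2.2 (Platt) and Lemma 2.4 (Landau,
DISTINCT real primitive characters), that at most one CHARACTER has a real zero in the Page window
`s ≥ 1 − (15 − 10√2)/(2(5 − √5) log Q)`, and that its modulus exceeds `400 000`. The tree's
rendering `thornerZaman2024_corollary25` also identifies the two ZEROS (`β = β'`); for two real zeros
of the SAME character this needs a single-character Page lemma ("`L(s,χ)`, `χ` real non-principal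
mod `q`, has at most one real zero in `(1 − c₁/log q, 1)`") with `c₁ > pageConst = 0.155…`, which
§2.2 of the source does not print (its Lemma 2.3 = McCurley's region has `c = 0.1036… < pageConst`).
The explicit lemma of record is Morrill–Trudgian, J. Number Theory (2020) = arXiv:1811.12521, Thm 2
(`c₁ = 0.933` in the refereed version J. Number Theory 212 (2020) 448–457, `1.011` in arXiv v1; all `q ≥ 3`;
cell rows r3-T31/T31corr). Under D-0026 it is NOT introduced here as a named
fact; the bridge below carries it as an explicit hypothesis binder `SingleCharacterPage c₁`-style
statement written inline, so that the day a cited `def` for it lands the corollary follows by one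
application. The two clauses that need no such lemma are proved outright from the tree's facts. -/

/-- `pageConst < 1/5` (numerically `pageConst = 0.1551…`): `15 − 10√2 < 1` because `√2 > 1.4`,
and `2(5 − √5) > 5.5` because `√5 < 2.25`, so `pageConst < 1/5.5 < 1/5`.
[cite: ThornerZaman2024LogFree, Corollary 2.5 (the constant 0.1551891…)] -/
theorem ThornerZaman2024.pageConst_lt_one_fifth : pageConst < 1 / 5 := by
  unfold pageConst
  have h2 : (1.4 : ℝ) < Real.sqrt 2 := by
    rw [show (1.4 : ℝ) = Real.sqrt (1.4 ^ 2) by rw [Real.sqrt_sq (by norm_num)]]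
    exact Real.sqrt_lt_sqrt (by norm_num) (by norm_num)
  have h5 : Real.sqrt 5 < 2.25 := by
    rw [show (2.25 : ℝ) = Real.sqrt (2.25 ^ 2) by rw [Real.sqrt_sq (by norm_num)]]
    exact Real.sqrt_lt_sqrt (by norm_num) (by norm_num)
  have hden : (0 : ℝ) < 2 * (5 - Real.sqrt 5) := by nlinarith
  rw [div_lt_div_iff₀ hden (by norm_num)]
  nlinarith

/-- **Corollary 2.5, second clause — PROVED from Platt 2016 (Thms 7.1–7.2).** For `Q ≥ 3`, any
primitive quadratic `χ (mod q)`, `q ≤ Q`, with a real zero `β ≥ 1 − pageConst/log Q` has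
`q > 400 000` ("By Lemma 2.2, this ensures that `Q > 400 000` … we have that `min{q,q′} > 400 000`",
proof of Cor. 2.5, p. 5): such a `β` lies in `(0,1)` (`pageConst/log Q < 1/5`; `L(s,χ) ≠ 0` for
`Re s ≥ 1`; `ζ` has no positive real zero), so `LFunction_ofReal_ne_zero_of_platt2016` applies
below `400 000`. [cite: ThornerZaman2024LogFree, Corollary 2.5 (proof)] [cite: Platt2016GRH, Theorems 7.1 and 7.2] -/
theorem thornerZaman2024_corollary25_level_of_platt (h71 : platt2016_theorem71)
    (h72 : platt2016_theorem72) {Q : ℝ} (hQ3 : 3 ≤ Q) {q : ℕ} [NeZero q]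
    (χ : DirichletCharacter ℂ q) (hprim : χ.IsPrimitive) {β : ℝ} (hz : χ.LFunction β = 0)
    (hβ : 1 - pageConst / Real.log Q ≤ β) : 400000 < q := by
  have hlogQ : 1 < Real.log Q :=
    one_lt_log_three.trans_le (Real.log_le_log (by norm_num) hQ3)
  have hpc := ThornerZaman2024.pageConst_lt_one_fifth
  have hpc0 := ThornerZaman2024.pageConst_pos
  have hβ0 : 0 < β := by
    have : pageConst / Real.log Q < 1 := by
      rw [div_lt_one (by linarith)]; linarith
    linarith
  -- `q ≠ 1`: `ζ` has no positive real zero; then `β < 1` by non-vanishing on `Re s ≥ 1`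
  rcases Nat.lt_or_ge 1 q with hq2 | hq1
  · have hne : χ ≠ 1 := SiegelZeroQuality.ne_one_of_isPrimitive hprim hq2
    have hβ1 : β < 1 := by
      by_contra hge
      exact DirichletCharacter.LFunction_ne_zero_of_one_le_re χ (Or.inl hne)
        (by simpa using not_lt.mp hge) hz
    by_contra hle
    exact LFunction_ofReal_ne_zero_of_platt2016 h71 h72 hq2 (not_lt.mp hle) hprim hβ0 hβ1 hz
  · exfalso
    have hq : q = 1 := le_antisymm hq1 (Nat.one_le_iff_ne_zero.mpr (NeZero.ne q))
    subst hq
    rw [DirichletCharacter.LFunction_modOne_eq] at hz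
    rcases lt_or_ge β 1 with h1 | h1
    · exact riemannZeta_ofReal_ne_zero_of_pos_of_lt_one β hβ0 h1 hz
    · exact riemannZeta_ne_zero_of_one_le_re (s := (β : ℂ)) (by simpa using h1) hz

/-- The window comparison behind Corollary 2.5: for `400 000 < q, q' ≤ Q` (so `qq'/17 > 1` and
`qq'/17 ≤ Q²`), `1 − landauConst/log(q'q/17) ≤ 1 − pageConst/log Q`, because
`pageConst = landauConst/2` and `log(q'q/17) ≤ 2 log Q` ("`β₁(Q) ≥ 1 − (15−10√2)/(2(5−√5)log Q)
≥ 1 − (15−10√2)/((5−√5) log(q′q))`", proof of Cor. 2.5).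
[cite: ThornerZaman2024LogFree, Corollary 2.5 (proof, displayed inequality)] -/
private theorem landau_window_le_page_window {Q : ℝ} (hQ3 : 3 ≤ Q) {q q' : ℕ} (hq : 400000 < q)
    (hq' : 400000 < q') (hqQ : (q : ℝ) ≤ Q) (hq'Q : (q' : ℝ) ≤ Q) :
    1 - landauConst / Real.log ((q' : ℝ) * q / 17) ≤ 1 - pageConst / Real.log Q := by
  have hqR : (400000 : ℝ) < q := by exact_mod_cast hq
  have hq'R : (400000 : ℝ) < q' := by exact_mod_cast hq'
  have hlogQ : 1 < Real.log Q :=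
    one_lt_log_three.trans_le (Real.log_le_log (by norm_num) hQ3)
  have hL0 : 0 < landauConst := by
    have := ThornerZaman2024.pageConst_pos
    rw [ThornerZaman2024.pageConst_eq_half_landauConst] at this
    linarith
  -- `1 < q'q/17 ≤ Q²`
  have hprod_gt : (1 : ℝ) < (q' : ℝ) * q / 17 := by
    rw [lt_div_iff₀ (by norm_num)]; nlinarith
  have hprod_le : (q' : ℝ) * q / 17 ≤ Q * Q := by
    rw [div_le_iff₀ (by norm_num)]
    have : (q' : ℝ) * q ≤ Q * Q := mul_le_mul hq'Q hqQ (by positivity) (by linarith)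
    nlinarith
  have hlog_pos : 0 < Real.log ((q' : ℝ) * q / 17) := Real.log_pos hprod_gt
  have hlog_le : Real.log ((q' : ℝ) * q / 17) ≤ 2 * Real.log Q := by
    have h := Real.log_le_log (by linarith) hprod_le
    rw [Real.log_mul (by linarith) (by linarith)] at h
    linarith
  -- compare the two windows
  rw [ThornerZaman2024.pageConst_eq_half_landauConst]
  have : landauConst / 2 / Real.log Q ≤ landauConst / Real.log ((q' : ℝ) * q / 17) := by
    rw [div_div, div_le_div_iff₀ (by positivity) hlog_pos]
    nlinarith
  linarith

/-- **Corollary 2.5, distinct-character part — PROVED from Lemma 2.4 (Landau, named fact) and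
Platt 2016.** For `Q ≥ 3`, two DISTINCT primitive quadratic characters `χ (mod q)`, `χ' (mod q')`,
`q, q' ≤ Q`, cannot both have a real zero in the Page window `s ≥ 1 − pageConst/log Q`: both moduli
exceed `400 000` (`thornerZaman2024_corollary25_level_of_platt`), and Lemma 2.4 gives
`min{β,β'} < 1 − landauConst/log(q'q/17) ≤ 1 − pageConst/log Q` (`landau_window_le_page_window`).
This is exactly the printed argument ("contradicting Lemma 2.4. Therefore, at most one such character
exists"). [cite: ThornerZaman2024LogFree, Corollary 2.5 (proof)] -/
theorem thornerZaman2024_corollary25_distinct_of_lemma24_platt (h24 : thornerZaman2024_lemma24)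
    (h71 : platt2016_theorem71) (h72 : platt2016_theorem72) {Q : ℝ} (hQ3 : 3 ≤ Q)
    {q q' : ℕ} [NeZero q] [NeZero q'] (χ : DirichletCharacter ℂ q) (χ' : DirichletCharacter ℂ q')
    (hqQ : (q : ℝ) ≤ Q) (hq'Q : (q' : ℝ) ≤ Q) (hχp : χ.IsPrimitive) (hχq : χ.IsQuadratic)
    (hχ'p : χ'.IsPrimitive) (hχ'q : χ'.IsQuadratic) (hdist : q ≠ q' ∨ ∃ h : q = q', h ▸ χ ≠ χ')
    {β β' : ℝ} (hz : χ.LFunction β = 0) (hz' : χ'.LFunction β' = 0)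
    (hβ : 1 - pageConst / Real.log Q ≤ β) (hβ' : 1 - pageConst / Real.log Q ≤ β') : False := by
  have hq : 400000 < q := thornerZaman2024_corollary25_level_of_platt h71 h72 hQ3 χ hχp hz hβ
  have hq' : 400000 < q' := thornerZaman2024_corollary25_level_of_platt h71 h72 hQ3 χ' hχ'p hz' hβ'
  have hmin := h24 q q' χ χ' hq hq' hχp hχq hχ'p hχ'q hdist β β' hz hz'
  have hwin := landau_window_le_page_window hQ3 hq hq' hqQ hq'Q
  have hle : 1 - pageConst / Real.log Q ≤ min β β' := le_min hβ hβ'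
  linarith

/-- **Corollary 2.5 (tree rendering `thornerZaman2024_corollary25`) from Lemma 2.4, Platt 2016, and
a single-character Page lemma.** The last hypothesis is the explicit single-character Page theorem
in the shape of Morrill–Trudgian 2020, Thm 2, with any constant `c₁ > pageConst = 0.155…` (print:
`c₁ = 0.933` refereed / `1.011` arXiv v1, all `q ≥ 3`, real non-principal `χ`; cell rows r3-T31/T31corr) —
stated INLINE as a binder
(not a named fact of this file, D-0026): for a quadratic `χ ≠ χ₀` mod `q ≥ 3`, two distinct real
zeros satisfy `min{β,β'} ≤ 1 − c₁/log q`. Given it, the same-character case closes because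
`1 − c₁/log q < 1 − pageConst/log Q` for `3 ≤ q ≤ Q` (`c₁ > pageConst > 0`, `0 < log q ≤ log Q`);
the distinct-character case and the modulus floor are the two theorems above.
[cite: ThornerZaman2024LogFree, Corollary 2.5] -/
theorem thornerZaman2024_corollary25_of_lemma24_platt_singlePage (h24 : thornerZaman2024_lemma24)
    (h71 : platt2016_theorem71) (h72 : platt2016_theorem72) {c₁ : ℝ} (hc₁ : pageConst < c₁)
    (hPage : ∀ (q : ℕ) [NeZero q], 3 ≤ q → ∀ χ : DirichletCharacter ℂ q, χ.IsQuadratic → χ ≠ 1 →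
      ∀ β β' : ℝ, β ≠ β' → χ.LFunction β = 0 → χ.LFunction β' = 0 →
        min β β' ≤ 1 - c₁ / Real.log q) :
    thornerZaman2024_corollary25 := by
  intro Q hQ3
  refine ⟨?_, fun q _ χ _ hχp _ β hz hβ ↦
    thornerZaman2024_corollary25_level_of_platt h71 h72 hQ3 χ hχp hz hβ⟩
  intro q q' _ _ χ χ' hqQ hq'Q hχp hχq hχ'p hχ'q β β' hz hz' hβ hβ'
  by_cases hqq : q = q'
  · subst hqq
    by_cases hχχ : χ = χ'
    · subst hχχ
      refine ⟨?_, rfl, rfl⟩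
      by_contra hββ
      -- same character, two distinct real zeros in the Page window: the single-character lemma
      have hq : 400000 < q := thornerZaman2024_corollary25_level_of_platt h71 h72 hQ3 χ hχp hz hβ
      have hq3 : 3 ≤ q := by omega
      have hne : χ ≠ 1 := SiegelZeroQuality.ne_one_of_isPrimitive hχp (by omega)
      have hmin := hPage q hq3 χ hχq hne β β' hββ hz hz'
      have hqR : (3 : ℝ) ≤ q := by exact_mod_cast hq3
      have hlogq : 1 < Real.log q :=
        one_lt_log_three.trans_le (Real.log_le_log (by norm_num) hqR)
      have hlogqQ : Real.log q ≤ Real.log Q := Real.log_le_log (by linarith) hqQ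
      have hpc0 := ThornerZaman2024.pageConst_pos
      -- `pageConst / log Q < c₁ / log q`
      have hcmp : pageConst / Real.log Q < c₁ / Real.log q :=
        calc pageConst / Real.log Q ≤ pageConst / Real.log q :=
              div_le_div_of_nonneg_left hpc0.le (by linarith) hlogqQ
          _ < c₁ / Real.log q := div_lt_div_of_pos_right hc₁ (by linarith)
      have hle : 1 - pageConst / Real.log Q ≤ min β β' := le_min hβ hβ'
      linarith
    · exact (thornerZaman2024_corollary25_distinct_of_lemma24_platt h24 h71 h72 hQ3 χ χ' hqQ hq'Q
        hχp hχq hχ'p hχ'q (Or.inr ⟨rfl, hχχ⟩) hz hz' hβ hβ').elim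
  · exact (thornerZaman2024_corollary25_distinct_of_lemma24_platt h24 h71 h72 hQ3 χ χ' hqQ hq'Q
      hχp hχq hχ'p hχ'q (Or.inl hqq) hz hz' hβ hβ').elim

/-! ### Part 3 — Theorem 2.6, first assertion, in the OPEN region: no zero of `𝓛(s,Q)` other
than `β₁(Q)` has `Re ρ > 1 − c/log max{Q, Q|Im ρ|}`

The named fact `thornerZaman2024_theorem26a` renders the source's CLOSED region ("`𝓛(s,Q)` is
nonzero in `Re(s) ≥ 1 − c/log max{Q,Q|Im(s)|}` except possibly at `β₁(Q)`", i.e. every other zero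
has `Re ρ <` the threshold). McCurley's Theorem 1 is carried by the tree with the OPEN region
(`AtMostOneZeroInRegion`: pairs of zeros with `Re s >` the threshold), so from it we derive the
open-region form: every zero `ρ ≠ β₁(Q)` has `Re ρ ≤ 1 − c/log max{Q, Q|Im ρ|}` — Theorem 2.6(a) up
to its boundary. The printed proof ("Lemma 2.3 and Corollary 2.5 imply the rest") is followed:
modulus `1` (`ζ`) by Lemma 2.1 (Platt–Trudgian's RH height and the Mossinghoff–Trudgian(–Yang)
region: tree facts `platt_trudgian_numerical_rh`, `zero_free_region_mossinghoff_trudgian_yang`);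
moduli `2 ≤ q ≤ 400 000` at height `|γ| ≤ 10⁸/q` by Lemma 2.2 (Platt, `platt2016_theorem71`);
everything else by Lemma 2.3 (McCurley, `McCurley1984_theorem1`: the zero is real and its character
quadratic), and then, for a real zero `β ≠ β₁(Q)` in the window: `β < β₁(Q)`, `β₁(Q)` is attained
(`exists_primitive_of_lt_betaOne`) at a quadratic `χ₁ (mod q₁)`, `q₁ > 400 000` (Platt), and either
`χ₁ = χ` (two zeros of one character in McCurley's region — excluded by McCurley) or `χ₁ ≠ χ`
(excluded by Lemma 2.4 = `thornerZaman2024_lemma24`, since `c = 0.1036… ≤ pageConst = 0.1551…`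
and `log(q₁q/17) ≤ 2 log Q`). -/

/-- `zfrConst ≤ pageConst` (`0.1036… ≤ 0.1551…`): `√2 < 1.415` and `√5 > 2.2` give
`pageConst > (15 − 14.15)/(2·2.8) = 0.85/5.6 > 0.15 > 1/9.6 > zfrConst`.
[cite: ThornerZaman2024LogFree, Lemma 2.3 and Corollary 2.5 (the two constants)] -/
theorem ThornerZaman2024.zfrConst_le_pageConst : zfrConst ≤ pageConst := by
  unfold zfrConst pageConst
  have h2 : Real.sqrt 2 < 1.415 := by
    rw [show (1.415 : ℝ) = Real.sqrt (1.415 ^ 2) by rw [Real.sqrt_sq (by norm_num)]]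
    exact Real.sqrt_lt_sqrt (by norm_num) (by norm_num)
  have h5 : (2.2 : ℝ) < Real.sqrt 5 := by
    rw [show (2.2 : ℝ) = Real.sqrt (2.2 ^ 2) by rw [Real.sqrt_sq (by norm_num)]]
    exact Real.sqrt_lt_sqrt (by norm_num) (by norm_num)
  have h5' : Real.sqrt 5 < 2.25 := by
    rw [show (2.25 : ℝ) = Real.sqrt (2.25 ^ 2) by rw [Real.sqrt_sq (by norm_num)]]
    exact Real.sqrt_lt_sqrt (by norm_num) (by norm_num)
  have hden : (0 : ℝ) < 2 * (5 - Real.sqrt 5) := by nlinarith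
  rw [div_le_div_iff₀ (by norm_num) hden]
  nlinarith

/-- A Dirichlet character modulo `2` is the principal one (the unit group of `ZMod 2` is trivial),
so no character modulo `2` is primitive of conductor `2`. [folklore] -/
private theorem dirichletCharacter_two_eq_one (χ : DirichletCharacter ℂ 2) : χ = 1 := by
  refine MulChar.ext fun u ↦ ?_
  have hu : u = 1 := by
    have : Fintype.card (ZMod 2)ˣ ≤ 1 := by
      rw [ZMod.card_units_eq_totient]; decide
    exact Fintype.card_le_one_iff_subsingleton.mp this |>.elim u 1
  subst hu
  simp

/-- The modulus-`1` case of Theorem 2.6(a) (the source's Lemma 2.1): a zero `ρ` of `ζ` (Mathlib's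
value at `s = 1` is nonzero, so no exclusion is needed) has `Re ρ ≤ 1 − c/log max{Q, Q|Im ρ|}` for
every `Q ≥ 3`, given RH up to height `3 000 175 332 800`
(Platt–Trudgian) and the Mossinghoff–Trudgian–Yang region `1 − 1/(5.558691 log|t|)` (`|t| ≥ 2`;
the source quotes Mossinghoff–Trudgian's `5.573412`, which the sharper `5.558691` implies).
[cite: ThornerZaman2024LogFree, Lemma 2.1 and Theorem 2.6 (proof)]
[cite: PlattTrudgian2021, Theorem 1] [cite: MossinghoffTrudgianYangRNT2024, Theorem 1] -/
theorem ThornerZaman2024.zeta_re_le_threshold (hRH : platt_trudgian_numerical_rh)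
    (hZ : zero_free_region_mossinghoff_trudgian_yang) {Q : ℝ} (hQ3 : 3 ≤ Q) {ρ : ℂ}
    (hz : riemannZeta ρ = 0) : ρ.re ≤ 1 - zfrConst / Real.log (max Q (Q * |ρ.im|)) := by
  by_contra hlt
  rw [not_le] at hlt
  set T := max Q (Q * |ρ.im|) with hT
  have hTQ : Q ≤ T := le_max_left _ _
  have hlogT : 1 < Real.log T :=
    one_lt_log_three.trans_le (Real.log_le_log (by norm_num) (hQ3.trans hTQ))
  have hc0 : 0 < zfrConst := by unfold zfrConst; norm_num
  have hc1 := ThornerZaman2024.zfrConst_lt_one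
  have hthr : 1 - zfrConst < 1 - zfrConst / Real.log T := by
    have : zfrConst / Real.log T < zfrConst := by
      rw [div_lt_iff₀ (by linarith)]; nlinarith
    linarith
  have hre_pos : 0 < ρ.re := by linarith
  -- `Re ρ < 1`
  have hre1 : ρ.re < 1 := by
    by_contra hge
    exact riemannZeta_ne_zero_of_one_le_re (s := ρ) (not_lt.mp hge) hz
  -- `Im ρ ≠ 0`: no real zero of `ζ` in `(0,1)`
  have him : ρ.im ≠ 0 := by
    intro him
    exact riemannZeta_ne_zero_of_im_eq_zero_of_pos_of_lt_one him hre_pos hre1 hz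
  rcases le_or_gt |ρ.im| 3000175332800 with hlow | hhigh
  · -- RH verified: `Re ρ = 1/2`, via `ρ` or its conjugate
    have hhalf : ρ.re = 1 / 2 := by
      rcases lt_or_gt_of_ne him with hneg | hpos
      · have hz' : riemannZeta (starRingEnd ℂ ρ) = 0 := by rw [riemannZeta_conj, hz, map_zero]
        have h := hRH (starRingEnd ℂ ρ) hz' (by simpa using hneg)
          (by simpa [abs_of_neg hneg] using hlow)
        simpa using h
      · exact hRH ρ hz hpos (by simpa [abs_of_pos hpos] using hlow)
    have hc2 : zfrConst < 1 / 2 := by unfold zfrConst; norm_num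
    have : zfrConst / Real.log T < 1 / 2 := by
      rw [div_lt_iff₀ (by linarith)]; nlinarith
    linarith
  · -- Mossinghoff–Trudgian–Yang above the RH height
    have hγ2 : (2 : ℝ) ≤ |ρ.im| := by linarith
    have hγ1 : (1 : ℝ) < |ρ.im| := by linarith
    have hlogγ : 0 < Real.log |ρ.im| := Real.log_pos hγ1
    have hTγ : |ρ.im| ≤ T := by
      have : |ρ.im| ≤ Q * |ρ.im| := by nlinarith [abs_nonneg ρ.im]
      exact this.trans (le_max_right _ _)
    have hlog_le : Real.log |ρ.im| ≤ Real.log T := Real.log_le_log (by linarith) hTγ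
    have hcmp : 1 - 1 / (5.558691 * Real.log |ρ.im|) ≤ 1 - zfrConst / Real.log T := by
      have h1 : zfrConst / Real.log T ≤ zfrConst / Real.log |ρ.im| :=
        div_le_div_of_nonneg_left hc0.le hlogγ hlog_le
      have h2 : zfrConst / Real.log |ρ.im| ≤ 1 / (5.558691 * Real.log |ρ.im|) := by
        unfold zfrConst
        rw [div_le_div_iff₀ hlogγ (by positivity)]
        nlinarith
      linarith
    have hne := hZ ρ.re ρ.im hγ2 (hcmp.trans hlt.le)
    rw [Complex.re_add_im] at hne
    exact hne hz

/-- Comparison of McCurley's threshold at modulus `q` with the family threshold at `Q ≥ q`: if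
`max{q, q|t|, 10} ≤ max{Q, Q|t|}` then `1 − 1/(R log max{q,q|t|,10}) ≤ 1 − (1/R)/log max{Q,Q|t|}`.
[cite: ThornerZaman2024LogFree, Lemma 2.3 (proof: McCurley's region with max{q,q|Im s|,10})] -/
private theorem mccurley_threshold_le {q : ℕ} {Q t : ℝ} (hq3 : 3 ≤ q)
    (hM : max (max (q : ℝ) ((q : ℝ) * |t|)) 10 ≤ max Q (Q * |t|)) :
    1 - 1 / (9.645908801 * Real.log (max (max (q : ℝ) ((q : ℝ) * |t|)) 10)) ≤
      1 - zfrConst / Real.log (max Q (Q * |t|)) := by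
  have hq : (3 : ℝ) ≤ q := by exact_mod_cast hq3
  have hM10 : (10 : ℝ) ≤ max (max (q : ℝ) ((q : ℝ) * |t|)) 10 := le_max_right _ _
  have hlogM : 0 < Real.log (max (max (q : ℝ) ((q : ℝ) * |t|)) 10) :=
    Real.log_pos (by linarith)
  have hlog_le : Real.log (max (max (q : ℝ) ((q : ℝ) * |t|)) 10) ≤ Real.log (max Q (Q * |t|)) :=
    Real.log_le_log (by linarith) hM
  have hlogT : 0 < Real.log (max Q (Q * |t|)) := hlogM.trans_le hlog_le
  unfold zfrConst
  have : 1 / 9.645908801 / Real.log (max Q (Q * |t|)) ≤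
      1 / (9.645908801 * Real.log (max (max (q : ℝ) ((q : ℝ) * |t|)) 10)) := by
    rw [div_div, div_le_div_iff₀ (by positivity) (by positivity)]
    nlinarith
  linarith

/-- **Thorner–Zaman 2024, Theorem 2.6, first assertion, OPEN-REGION form — DERIVED** from
McCurley's Theorem 1 (`McCurley1984_theorem1`), Platt 2016 (`platt2016_theorem71/72`), the two
`ζ` facts of the source's Lemma 2.1 (`platt_trudgian_numerical_rh`,
`zero_free_region_mossinghoff_trudgian_yang`) and Lemma 2.4 (`thornerZaman2024_lemma24`): for
`Q ≥ 3`, every zero `ρ ≠ 1`, `ρ ≠ β₁(Q)` of a primitive `L(s,χ)` of modulus `q ≤ Q` satisfies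
`Re ρ ≤ 1 − c/log max{Q, Q|Im ρ|}`, `c = 1/9.645908801`. This is the named fact
`thornerZaman2024_theorem26a` except on the boundary `Re ρ = 1 − c/log max{Q,Q|Im ρ|}` (the fact
has `<`; McCurley's region is open in the tree, closed in the source's Lemma 2.3).
[cite: ThornerZaman2024LogFree, Theorem 2.6 (first assertion) and its proof]
[cite: McCurley1984ZFR, Theorem 1] [cite: Platt2016GRH, Theorems 7.1 and 7.2] -/
theorem thornerZaman2024_theorem26a_open_of_mccurley_platt_lemma24 (hM : McCurley1984_theorem1)
    (h71 : platt2016_theorem71) (h72 : platt2016_theorem72) (hRH : platt_trudgian_numerical_rh)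
    (hZ : zero_free_region_mossinghoff_trudgian_yang) (h24 : thornerZaman2024_lemma24) :
    ∀ Q : ℝ, 3 ≤ Q → ∀ (q : ℕ) [NeZero q] (χ : DirichletCharacter ℂ q), (q : ℝ) ≤ Q →
      χ.IsPrimitive → ∀ ρ : ℂ, ρ ≠ 1 → ρ ≠ ((betaOne Q : ℝ) : ℂ) → χ.LFunction ρ = 0 →
        ρ.re ≤ 1 - zfrConst / Real.log (max Q (Q * |ρ.im|)) := by
  intro Q hQ3 q _ χ hqQ hprim ρ hρ1 hρβ hz
  -- modulus 1: `ζ`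
  rcases Nat.lt_or_ge 1 q with hq2 | hq1
  swap
  · have hq : q = 1 := le_antisymm hq1 (Nat.one_le_iff_ne_zero.mpr (NeZero.ne q))
    subst hq
    rw [DirichletCharacter.LFunction_modOne_eq] at hz
    exact ThornerZaman2024.zeta_re_le_threshold hRH hZ hQ3 hz
  -- modulus `q ≥ 2`
  have hne : χ ≠ 1 := SiegelZeroQuality.ne_one_of_isPrimitive hprim hq2
  by_contra hlt
  rw [not_le] at hlt
  set T := max Q (Q * |ρ.im|) with hT
  have hTQ : Q ≤ T := le_max_left _ _
  have hlogT : 1 < Real.log T :=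
    one_lt_log_three.trans_le (Real.log_le_log (by norm_num) (hQ3.trans hTQ))
  have hc0 : 0 < zfrConst := by unfold zfrConst; norm_num
  have hc1 := ThornerZaman2024.zfrConst_lt_one
  have hthrQ : 1 - zfrConst < 1 - zfrConst / Real.log T := by
    have : zfrConst / Real.log T < zfrConst := by
      rw [div_lt_iff₀ (by linarith)]; nlinarith
    linarith
  have hre_pos : 0 < ρ.re := by linarith
  have hre1 : ρ.re < 1 := by
    by_contra hge
    exact DirichletCharacter.LFunction_ne_zero_of_one_le_re χ (Or.inl hne) (not_lt.mp hge) hz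
  have hqR : (q : ℝ) ≤ Q := hqQ
  -- Platt's range at low height
  by_cases hPl : q ≤ 400000 ∧ |ρ.im| ≤ 10 ^ 8 / (q : ℝ)
  · have hgrh := grhUpTo_of_platt2016 (q := q) h71 hPl.1 χ hne
    have hhalf : ρ.re = 1 / 2 := hgrh ρ hz hre_pos hre1 hPl.2
    have hc2 : zfrConst < 1 / 2 := by unfold zfrConst; norm_num
    have : zfrConst / Real.log T < 1 / 2 := by
      rw [div_lt_iff₀ (by linarith)]; nlinarith
    linarith
  -- otherwise McCurley applies at modulus `q ≥ 3`
  have hq3 : 3 ≤ q := by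
    by_contra hq3
    have hq2' : q = 2 := by omega
    subst hq2'
    exact hne (dirichletCharacter_two_eq_one χ)
  have hq3R : (3 : ℝ) ≤ q := by exact_mod_cast hq3
  -- `max{q, q|γ|, 10} ≤ T`
  have hMle : max (max (q : ℝ) ((q : ℝ) * |ρ.im|)) 10 ≤ T := by
    have h1 : (q : ℝ) * |ρ.im| ≤ Q * |ρ.im| :=
      mul_le_mul_of_nonneg_right hqR (abs_nonneg _)
    have h10 : (10 : ℝ) ≤ T := by
      rw [not_and_or] at hPl
      rcases hPl with hbig | hhigh
      · have : (400000 : ℝ) < q := by exact_mod_cast (not_le.mp hbig)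
        linarith
      · rw [not_le] at hhigh
        have hqpos : (0 : ℝ) < q := by linarith
        have : (10 : ℝ) ^ 8 < (q : ℝ) * |ρ.im| := by
          have := (div_lt_iff₀ hqpos).mp hhigh
          linarith
        have : (10 : ℝ) ≤ Q * |ρ.im| := by nlinarith
        exact this.trans (le_max_right _ _)
    exact max_le (max_le (hqR.trans hTQ) (h1.trans (le_max_right _ _))) h10
  have hthrM := mccurley_threshold_le (t := ρ.im) hq3 hMle
  -- McCurley at `(χ, ρ), (χ, ρ)`: `ρ` is real and `χ` is quadratic
  obtain ⟨-, him0, -, hχsq⟩ := hM q hq3 χ χ ρ ρ hρ1 hρ1 (hthrM.trans_lt hlt) (hthrM.trans_lt hlt) hz hz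
  -- hence not in Platt's complement by height: `q > 400 000`
  have hq4 : 400000 < q := by
    by_contra hle
    rw [not_and_or] at hPl
    rcases hPl with hbig | hhigh
    · exact hbig (not_lt.mp hle)
    · rw [him0, abs_zero] at hhigh
      exact hhigh (by positivity)
  -- `ρ = β` real, in the window `β > 1 − c/log Q`
  set β : ℝ := ρ.re with hβdef
  have hρeq : ρ = (β : ℂ) := Complex.ext (by simp [hβdef]) (by simp [him0])
  have hTq : T = Q := by
    rw [hT, him0, abs_zero, mul_zero]; exact max_eq_left (by linarith)
  rw [hTq] at hlt
  have hzβ : χ.LFunction (β : ℂ) = 0 := by rw [← hρeq]; exact hz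
  have hχq : χ.IsQuadratic := MulChar.isQuadratic_iff_sq_eq_one.mpr hχsq
  -- `β ≤ β₁(Q)` and `β ≠ β₁(Q)`, so `β < β₁(Q)`; attainment at `χ₁ mod q₁`
  have hβle : β ≤ betaOne Q := ThornerZaman2024.le_betaOne hqR hprim hzβ
  have hβne : β ≠ betaOne Q := by
    intro h; exact hρβ (by rw [hρeq, h])
  have hβlt : β < betaOne Q := lt_of_le_of_ne hβle hβne
  obtain ⟨q₁, _, χ₁, hq₁2, hq₁Q, hprim₁, hz₁⟩ := exists_primitive_of_lt_betaOne hre_pos hβlt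
  have hβ₁1 : betaOne Q < 1 := betaOne_lt_one hre_pos hβlt
  have hq₁4 : 400000 < q₁ := by
    by_contra hle
    exact LFunction_ofReal_ne_zero_of_platt2016 h71 h72 hq₁2 (not_lt.mp hle) hprim₁
      (hre_pos.trans hβlt) hβ₁1 hz₁
  have hq₁3 : 3 ≤ q₁ := by omega
  -- McCurley's threshold at a real point of modulus `q' ≤ Q`, `q' ≥ 3`, is below `1 − c/log Q`
  have hthr_real : ∀ {q' : ℕ}, 3 ≤ q' → ((q' : ℝ) ≤ Q) → ∀ {x : ℝ},
      1 - zfrConst / Real.log Q < x →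
      1 - 1 / (9.645908801 * Real.log (max (max (q' : ℝ) ((q' : ℝ) * |((x : ℂ)).im|)) 10)) < x := by
    intro q' hq' hq'Q x hx
    have hMle' : max (max (q' : ℝ) ((q' : ℝ) * |((x : ℂ)).im|)) 10 ≤ max Q (Q * |((x : ℂ)).im|) := by
      simp only [Complex.ofReal_im, abs_zero, mul_zero]
      have hq'3 : (3 : ℝ) ≤ q' := by exact_mod_cast hq'
      refine max_le (max_le (hq'Q.trans (le_max_left _ _)) ?_) ?_
      · exact le_trans (by linarith) (le_max_left _ _)
      · -- `10 ≤ Q` since `Q ≥ q > 400 000`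
        have : (400000 : ℝ) < q := by exact_mod_cast hq4
        exact le_trans (by linarith) (le_max_left _ _)
    have h := mccurley_threshold_le (t := ((x : ℂ)).im) hq' hMle'
    have hQeq : max Q (Q * |((x : ℂ)).im|) = Q := by
      simp only [Complex.ofReal_im, abs_zero, mul_zero]; exact max_eq_left (by linarith)
    rw [hQeq] at h
    exact h.trans_lt hx
  have hβ₁win : 1 - zfrConst / Real.log Q < betaOne Q := hlt.trans hβlt
  have hβ₁ne1 : ((betaOne Q : ℝ) : ℂ) ≠ 1 := by
    intro h; exact (ne_of_lt hβ₁1) (by exact_mod_cast h)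
  have hβne1 : ((β : ℂ)) ≠ 1 := by rw [← hρeq]; exact hρ1
  -- McCurley at `(χ₁, β₁), (χ₁, β₁)`: `χ₁` is quadratic
  obtain ⟨-, -, hχ₁ne, hχ₁sq⟩ := hM q₁ hq₁3 χ₁ χ₁ _ _ hβ₁ne1 hβ₁ne1
    (hthr_real hq₁3 hq₁Q hβ₁win) (hthr_real hq₁3 hq₁Q hβ₁win) hz₁ hz₁
  have hχ₁q : χ₁.IsQuadratic := MulChar.isQuadratic_iff_sq_eq_one.mpr hχ₁sq
  -- the Page/Landau windows: `1 − c/log Q ≥ 1 − pageConst/log Q ≥ 1 − landauConst/log(q₁ q/17)`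
  have hlogQ : 1 < Real.log Q := one_lt_log_three.trans_le (Real.log_le_log (by norm_num) hQ3)
  have hwin1 : 1 - pageConst / Real.log Q ≤ 1 - zfrConst / Real.log Q := by
    have := div_le_div_of_nonneg_right ThornerZaman2024.zfrConst_le_pageConst (by linarith : (0:ℝ) ≤ Real.log Q)
    linarith
  by_cases hqq : q = q₁
  · subst hqq
    by_cases hχχ : χ = χ₁
    · subst hχχ
      -- two distinct real zeros `β < β₁(Q)` of one character in McCurley's region
      obtain ⟨⟨-, hs⟩, -⟩ := hM q hq3 χ χ _ _ hβne1 hβ₁ne1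
        (hthr_real hq3 hqR hlt) (hthr_real hq3 hqR hβ₁win) hzβ hz₁
      exact hβne (by exact_mod_cast hs)
    · have hmin := h24 q q χ χ₁ hq4 hq4 hprim hχq hprim₁ hχ₁q (Or.inr ⟨rfl, hχχ⟩) β (betaOne Q) hzβ hz₁
      have hwin2 := landau_window_le_page_window hQ3 hq4 hq4 hqR hqR
      have hmin_eq : min β (betaOne Q) = β := min_eq_left hβle
      rw [hmin_eq] at hmin
      linarith
  · have hmin := h24 q q₁ χ χ₁ hq4 hq₁4 hprim hχq hprim₁ hχ₁q (Or.inl hqq) β (betaOne Q) hzβ hz₁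
    have hwin2 := landau_window_le_page_window hQ3 hq4 hq₁4 hqR hq₁Q
    have hmin_eq : min β (betaOne Q) = β := min_eq_left hβle
    rw [hmin_eq] at hmin
    linarith

/-! ### Part 4 (2026-08-28, littype-FP2-1 g17): Theorem 2.6, first assertion — the NAMED FACT
`thornerZaman2024_theorem26a` DERIVED IN FULL from McCurley's Theorem 1 AS PRINTED (closed region)

McCurley, J. Number Theory 19 (1984) p. 8 prints the CLOSED region `{s : σ ⩾ 1 − 1/(R log M)}`
(page image rendered from the held scan, 2026-08-28; the OCR text layer had `>`), exactly as the
source's Lemma 2.3 restates it; the tree now carries it as `McCurley1984_theorem1_closed`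
(`ZeroFreeRegionUpTo.lean`). With the closed region the boundary case left open by Part 3
(`thornerZaman2024_theorem26a_open_of_mccurley_platt_lemma24`, conclusion `≤`) closes, and the
named fact (conclusion `<`, as printed: "`𝓛(s,Q)` is nonzero in the region
`Re(s) ≥ 1 − c/log max{Q, Q|Im(s)|}`" except at `β₁(Q)`) follows from
`McCurley1984_theorem1_closed`, Platt 2016 (Thms 7.1–7.2), the two `ζ` facts of Lemma 2.1
(`platt_trudgian_numerical_rh`, `zero_free_region_mossinghoff_trudgian_yang` — the latter itself a
theorem of the tree from the former) and Lemma 2.4 (`thornerZaman2024_lemma24`). The argument is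
the printed one ("Lemma 2.3 and Corollary 2.5 imply the rest"), verbatim as in Part 3 with `≤` on
the hypotheses side. -/

/-- The modulus-`1` case with the STRICT conclusion: a zero `ρ` of `ζ` has
`Re ρ < 1 − c/log max{Q, Q|Im ρ|}` for every `Q ≥ 3` (RH to height `3 000 175 332 800` puts the low
zeros at `Re = 1/2 < 1 − c`; above, the Mossinghoff–Trudgian–Yang region
`σ ≥ 1 − 1/(5.558691 log|t|)` is closed and wider). [cite: ThornerZaman2024LogFree, Lemma 2.1 and
Theorem 2.6 (proof)] [cite: PlattTrudgian2021, Theorem 1]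
[cite: MossinghoffTrudgianYangRNT2024, Theorem 1] -/
theorem ThornerZaman2024.zeta_re_lt_threshold (hRH : platt_trudgian_numerical_rh)
    (hZ : zero_free_region_mossinghoff_trudgian_yang) {Q : ℝ} (hQ3 : 3 ≤ Q) {ρ : ℂ}
    (hz : riemannZeta ρ = 0) : ρ.re < 1 - zfrConst / Real.log (max Q (Q * |ρ.im|)) := by
  by_contra hle
  rw [not_lt] at hle
  set T := max Q (Q * |ρ.im|) with hT
  have hTQ : Q ≤ T := le_max_left _ _
  have hlogT : 1 < Real.log T :=
    one_lt_log_three.trans_le (Real.log_le_log (by norm_num) (hQ3.trans hTQ))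
  have hc0 : 0 < zfrConst := by unfold zfrConst; norm_num
  have hc1 := ThornerZaman2024.zfrConst_lt_one
  have hthr : 1 - zfrConst < 1 - zfrConst / Real.log T := by
    have : zfrConst / Real.log T < zfrConst := by
      rw [div_lt_iff₀ (by linarith)]; nlinarith
    linarith
  have hre_pos : 0 < ρ.re := by linarith
  -- `Re ρ < 1`
  have hre1 : ρ.re < 1 := by
    by_contra hge
    exact riemannZeta_ne_zero_of_one_le_re (s := ρ) (not_lt.mp hge) hz
  -- `Im ρ ≠ 0`: no real zero of `ζ` in `(0,1)`
  have him : ρ.im ≠ 0 := by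
    intro him
    exact riemannZeta_ne_zero_of_im_eq_zero_of_pos_of_lt_one him hre_pos hre1 hz
  rcases le_or_gt |ρ.im| 3000175332800 with hlow | hhigh
  · -- RH verified: `Re ρ = 1/2`, via `ρ` or its conjugate
    have hhalf : ρ.re = 1 / 2 := by
      rcases lt_or_gt_of_ne him with hneg | hpos
      · have hz' : riemannZeta (starRingEnd ℂ ρ) = 0 := by rw [riemannZeta_conj, hz, map_zero]
        have h := hRH (starRingEnd ℂ ρ) hz' (by simpa using hneg)
          (by simpa [abs_of_neg hneg] using hlow)
        simpa using h
      · exact hRH ρ hz hpos (by simpa [abs_of_pos hpos] using hlow)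
    have hc2 : zfrConst < 1 / 2 := by unfold zfrConst; norm_num
    have : zfrConst / Real.log T < 1 / 2 := by
      rw [div_lt_iff₀ (by linarith)]; nlinarith
    linarith
  · -- Mossinghoff–Trudgian–Yang above the RH height (closed region)
    have hγ2 : (2 : ℝ) ≤ |ρ.im| := by linarith
    have hγ1 : (1 : ℝ) < |ρ.im| := by linarith
    have hlogγ : 0 < Real.log |ρ.im| := Real.log_pos hγ1
    have hTγ : |ρ.im| ≤ T := by
      have : |ρ.im| ≤ Q * |ρ.im| := by nlinarith [abs_nonneg ρ.im]
      exact this.trans (le_max_right _ _)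
    have hlog_le : Real.log |ρ.im| ≤ Real.log T := Real.log_le_log (by linarith) hTγ
    have hcmp : 1 - 1 / (5.558691 * Real.log |ρ.im|) ≤ 1 - zfrConst / Real.log T := by
      have h1 : zfrConst / Real.log T ≤ zfrConst / Real.log |ρ.im| :=
        div_le_div_of_nonneg_left hc0.le hlogγ hlog_le
      have h2 : zfrConst / Real.log |ρ.im| ≤ 1 / (5.558691 * Real.log |ρ.im|) := by
        unfold zfrConst
        rw [div_le_div_iff₀ hlogγ (by positivity)]
        nlinarith
      linarith
    have hne := hZ ρ.re ρ.im hγ2 (hcmp.trans hle)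
    rw [Complex.re_add_im] at hne
    exact hne hz

/-- **Thorner–Zaman 2024, Theorem 2.6, first assertion — the named fact
`thornerZaman2024_theorem26a` DERIVED** from McCurley's Theorem 1 AS PRINTED (closed region,
`McCurley1984_theorem1_closed`), Platt 2016 (`platt2016_theorem71/72`), the two `ζ` facts of the
source's Lemma 2.1 (`platt_trudgian_numerical_rh`, `zero_free_region_mossinghoff_trudgian_yang`)
and Lemma 2.4 (`thornerZaman2024_lemma24`): for `Q ≥ 3`, every zero `ρ ≠ 1`, `ρ ≠ β₁(Q)` of a
primitive `L(s,χ)` of modulus `q ≤ Q` satisfies `Re ρ < 1 − c/log max{Q, Q|Im ρ|}`,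
`c = 1/9.645908801` — "Except possibly at `β₁(Q)`, `𝓛(s,Q)` is nonzero in the region
`Re(s) ≥ 1 − c/log max{Q, Q|Im(s)|}`", as printed. Proof = Part 3 with McCurley's CLOSED region:
a zero on or above the threshold lies in McCurley's closed region at its own modulus (Lemma 2.3's
comparison `max{q, q|t|, 10} ≤ max{Q, Q|t|}` once `q > 400 000` or `q|t| > 10⁸`, Platt's table
otherwise), so it is a real zero `β` of a quadratic `χ`, `q > 400 000`; `β < β₁(Q)` (attained at a
primitive quadratic `χ₁ mod q₁`, `q₁ > 400 000` by Platt); the same character is excluded by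
McCurley (two zeros in the closed region), a different one by Lemma 2.4 (Landau) since
`1 − 0.3103…/log(q₁q/17) ≤ 1 − 0.1551…/log Q ≤ 1 − c/log Q ≤ β = min{β, β₁(Q)}`.
[cite: ThornerZaman2024LogFree, Theorem 2.6 (first assertion) and its proof]
[cite: McCurley1984ZFR, Theorem 1] [cite: Platt2016GRH, Theorems 7.1 and 7.2] -/
theorem thornerZaman2024_theorem26a_of_mccurleyClosed_platt_lemma24
    (hM : McCurley1984_theorem1_closed) (h71 : platt2016_theorem71) (h72 : platt2016_theorem72)
    (hRH : platt_trudgian_numerical_rh) (hZ : zero_free_region_mossinghoff_trudgian_yang)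
    (h24 : thornerZaman2024_lemma24) : thornerZaman2024_theorem26a := by
  intro Q hQ3 q _ χ hqQ hprim ρ hρ1 hρβ hz
  -- modulus 1: `ζ`
  rcases Nat.lt_or_ge 1 q with hq2 | hq1
  swap
  · have hq : q = 1 := le_antisymm hq1 (Nat.one_le_iff_ne_zero.mpr (NeZero.ne q))
    subst hq
    rw [DirichletCharacter.LFunction_modOne_eq] at hz
    exact ThornerZaman2024.zeta_re_lt_threshold hRH hZ hQ3 hz
  -- modulus `q ≥ 2`
  have hne : χ ≠ 1 := SiegelZeroQuality.ne_one_of_isPrimitive hprim hq2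
  by_contra hle
  rw [not_lt] at hle
  set T := max Q (Q * |ρ.im|) with hT
  have hTQ : Q ≤ T := le_max_left _ _
  have hlogT : 1 < Real.log T :=
    one_lt_log_three.trans_le (Real.log_le_log (by norm_num) (hQ3.trans hTQ))
  have hc0 : 0 < zfrConst := by unfold zfrConst; norm_num
  have hc1 := ThornerZaman2024.zfrConst_lt_one
  have hthrQ : 1 - zfrConst < 1 - zfrConst / Real.log T := by
    have : zfrConst / Real.log T < zfrConst := by
      rw [div_lt_iff₀ (by linarith)]; nlinarith
    linarith
  have hre_pos : 0 < ρ.re := by linarith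
  have hre1 : ρ.re < 1 := by
    by_contra hge
    exact DirichletCharacter.LFunction_ne_zero_of_one_le_re χ (Or.inl hne) (not_lt.mp hge) hz
  have hqR : (q : ℝ) ≤ Q := hqQ
  -- Platt's range at low height
  by_cases hPl : q ≤ 400000 ∧ |ρ.im| ≤ 10 ^ 8 / (q : ℝ)
  · have hgrh := grhUpTo_of_platt2016 (q := q) h71 hPl.1 χ hne
    have hhalf : ρ.re = 1 / 2 := hgrh ρ hz hre_pos hre1 hPl.2
    have hc2 : zfrConst < 1 / 2 := by unfold zfrConst; norm_num
    have : zfrConst / Real.log T < 1 / 2 := by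
      rw [div_lt_iff₀ (by linarith)]; nlinarith
    linarith
  -- otherwise McCurley applies at modulus `q ≥ 3`
  have hq3 : 3 ≤ q := by
    by_contra hq3
    have hq2' : q = 2 := by omega
    subst hq2'
    exact hne (dirichletCharacter_two_eq_one χ)
  have hq3R : (3 : ℝ) ≤ q := by exact_mod_cast hq3
  -- `max{q, q|γ|, 10} ≤ T`
  have hMle : max (max (q : ℝ) ((q : ℝ) * |ρ.im|)) 10 ≤ T := by
    have h1 : (q : ℝ) * |ρ.im| ≤ Q * |ρ.im| :=
      mul_le_mul_of_nonneg_right hqR (abs_nonneg _)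
    have h10 : (10 : ℝ) ≤ T := by
      rw [not_and_or] at hPl
      rcases hPl with hbig | hhigh
      · have : (400000 : ℝ) < q := by exact_mod_cast (not_le.mp hbig)
        linarith
      · rw [not_le] at hhigh
        have hqpos : (0 : ℝ) < q := by linarith
        have : (10 : ℝ) ^ 8 < (q : ℝ) * |ρ.im| := by
          have := (div_lt_iff₀ hqpos).mp hhigh
          linarith
        have : (10 : ℝ) ≤ Q * |ρ.im| := by nlinarith
        exact this.trans (le_max_right _ _)
    exact max_le (max_le (hqR.trans hTQ) (h1.trans (le_max_right _ _))) h10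
  have hthrM := mccurley_threshold_le (t := ρ.im) hq3 hMle
  -- McCurley (closed region) at `(χ, ρ), (χ, ρ)`: `ρ` is real and `χ` is quadratic
  obtain ⟨-, him0, -, hχsq⟩ :=
    hM q hq3 χ χ ρ ρ hρ1 hρ1 (hthrM.trans hle) (hthrM.trans hle) hz hz
  -- hence not in Platt's complement by height: `q > 400 000`
  have hq4 : 400000 < q := by
    by_contra hle4
    rw [not_and_or] at hPl
    rcases hPl with hbig | hhigh
    · exact hbig (not_lt.mp hle4)
    · rw [him0, abs_zero] at hhigh
      exact hhigh (by positivity)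
  -- `ρ = β` real, in the closed window `β ≥ 1 − c/log Q`
  set β : ℝ := ρ.re with hβdef
  have hρeq : ρ = (β : ℂ) := Complex.ext (by simp [hβdef]) (by simp [him0])
  have hTq : T = Q := by
    rw [hT, him0, abs_zero, mul_zero]; exact max_eq_left (by linarith)
  rw [hTq] at hle
  have hzβ : χ.LFunction (β : ℂ) = 0 := by rw [← hρeq]; exact hz
  have hχq : χ.IsQuadratic := MulChar.isQuadratic_iff_sq_eq_one.mpr hχsq
  -- `β ≤ β₁(Q)` and `β ≠ β₁(Q)`, so `β < β₁(Q)`; attainment at `χ₁ mod q₁`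
  have hβle : β ≤ betaOne Q := ThornerZaman2024.le_betaOne hqR hprim hzβ
  have hβne : β ≠ betaOne Q := by
    intro h; exact hρβ (by rw [hρeq, h])
  have hβlt : β < betaOne Q := lt_of_le_of_ne hβle hβne
  obtain ⟨q₁, _, χ₁, hq₁2, hq₁Q, hprim₁, hz₁⟩ := exists_primitive_of_lt_betaOne hre_pos hβlt
  have hβ₁1 : betaOne Q < 1 := betaOne_lt_one hre_pos hβlt
  have hq₁4 : 400000 < q₁ := by
    by_contra hle4
    exact LFunction_ofReal_ne_zero_of_platt2016 h71 h72 hq₁2 (not_lt.mp hle4) hprim₁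
      (hre_pos.trans hβlt) hβ₁1 hz₁
  have hq₁3 : 3 ≤ q₁ := by omega
  -- McCurley's threshold at a real point of modulus `q' ≤ Q`, `q' ≥ 3`, is at most `1 − c/log Q`
  have hthr_real : ∀ {q' : ℕ}, 3 ≤ q' → ((q' : ℝ) ≤ Q) → ∀ {x : ℝ},
      1 - zfrConst / Real.log Q ≤ x →
      1 - 1 / (9.645908801 * Real.log (max (max (q' : ℝ) ((q' : ℝ) * |((x : ℂ)).im|)) 10)) ≤ x := by
    intro q' hq' hq'Q x hx
    have hMle' : max (max (q' : ℝ) ((q' : ℝ) * |((x : ℂ)).im|)) 10 ≤ max Q (Q * |((x : ℂ)).im|) := by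
      simp only [Complex.ofReal_im, abs_zero, mul_zero]
      have hq'3 : (3 : ℝ) ≤ q' := by exact_mod_cast hq'
      refine max_le (max_le (hq'Q.trans (le_max_left _ _)) ?_) ?_
      · exact le_trans (by linarith) (le_max_left _ _)
      · -- `10 ≤ Q` since `Q ≥ q > 400 000`
        have : (400000 : ℝ) < q := by exact_mod_cast hq4
        exact le_trans (by linarith) (le_max_left _ _)
    have h := mccurley_threshold_le (t := ((x : ℂ)).im) hq' hMle'
    have hQeq : max Q (Q * |((x : ℂ)).im|) = Q := by
      simp only [Complex.ofReal_im, abs_zero, mul_zero]; exact max_eq_left (by linarith)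
    rw [hQeq] at h
    exact h.trans hx
  have hβ₁win : 1 - zfrConst / Real.log Q < betaOne Q := hle.trans_lt hβlt
  have hβ₁ne1 : ((betaOne Q : ℝ) : ℂ) ≠ 1 := by
    intro h; exact (ne_of_lt hβ₁1) (by exact_mod_cast h)
  have hβne1 : ((β : ℂ)) ≠ 1 := by rw [← hρeq]; exact hρ1
  -- McCurley at `(χ₁, β₁), (χ₁, β₁)`: `χ₁` is quadratic
  obtain ⟨-, -, hχ₁ne, hχ₁sq⟩ := hM q₁ hq₁3 χ₁ χ₁ _ _ hβ₁ne1 hβ₁ne1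
    (hthr_real hq₁3 hq₁Q hβ₁win.le) (hthr_real hq₁3 hq₁Q hβ₁win.le) hz₁ hz₁
  have hχ₁q : χ₁.IsQuadratic := MulChar.isQuadratic_iff_sq_eq_one.mpr hχ₁sq
  -- the Page/Landau windows: `1 − c/log Q ≥ 1 − pageConst/log Q ≥ 1 − landauConst/log(q₁ q/17)`
  have hlogQ : 1 < Real.log Q := one_lt_log_three.trans_le (Real.log_le_log (by norm_num) hQ3)
  have hwin1 : 1 - pageConst / Real.log Q ≤ 1 - zfrConst / Real.log Q := by
    have := div_le_div_of_nonneg_right ThornerZaman2024.zfrConst_le_pageConst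
      (by linarith : (0:ℝ) ≤ Real.log Q)
    linarith
  by_cases hqq : q = q₁
  · subst hqq
    by_cases hχχ : χ = χ₁
    · subst hχχ
      -- two distinct real zeros `β < β₁(Q)` of one character in McCurley's closed region
      obtain ⟨⟨-, hs⟩, -⟩ := hM q hq3 χ χ _ _ hβne1 hβ₁ne1
        (hthr_real hq3 hqR hle) (hthr_real hq3 hqR hβ₁win.le) hzβ hz₁
      exact hβne (by exact_mod_cast hs)
    · have hmin := h24 q q χ χ₁ hq4 hq4 hprim hχq hprim₁ hχ₁q (Or.inr ⟨rfl, hχχ⟩) β (betaOne Q)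
        hzβ hz₁
      have hwin2 := landau_window_le_page_window hQ3 hq4 hq4 hqR hqR
      have hmin_eq : min β (betaOne Q) = β := min_eq_left hβle
      rw [hmin_eq] at hmin
      linarith
  · have hmin := h24 q q₁ χ χ₁ hq4 hq₁4 hprim hχq hprim₁ hχ₁q (Or.inl hqq) β (betaOne Q) hzβ hz₁
    have hwin2 := landau_window_le_page_window hQ3 hq4 hq₁4 hqR hq₁Q
    have hmin_eq : min β (betaOne Q) = β := min_eq_left hβle
    rw [hmin_eq] at hmin
    linarith

/-- **Corollary: the open-form conclusion of Part 3 from the printed McCurley statement** (the named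
fact gives `<`, a fortiori `≤`). [cite: ThornerZaman2024LogFree, Theorem 2.6] -/
theorem thornerZaman2024_theorem26a_le_of_mccurleyClosed (hM : McCurley1984_theorem1_closed)
    (h71 : platt2016_theorem71) (h72 : platt2016_theorem72) (hRH : platt_trudgian_numerical_rh)
    (hZ : zero_free_region_mossinghoff_trudgian_yang) (h24 : thornerZaman2024_lemma24) :
    ∀ Q : ℝ, 3 ≤ Q → ∀ (q : ℕ) [NeZero q] (χ : DirichletCharacter ℂ q), (q : ℝ) ≤ Q →
      χ.IsPrimitive → ∀ ρ : ℂ, ρ ≠ 1 → ρ ≠ ((betaOne Q : ℝ) : ℂ) → χ.LFunction ρ = 0 →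
        ρ.re ≤ 1 - zfrConst / Real.log (max Q (Q * |ρ.im|)) :=
  fun Q hQ q _ χ hqQ hprim ρ h1 hβ hz ↦
    (thornerZaman2024_theorem26a_of_mccurleyClosed_platt_lemma24 hM h71 h72 hRH hZ h24 Q hQ q χ hqQ
      hprim ρ h1 hβ hz).le

end Literature.NumberTheory.LFunctions
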